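import Literature.AlgebraicTopology.SingularHomology.TorusCapProductPontryaginMonomials
import Literature.AlgebraicTopology.SingularHomology.ClopenCountFunctional
import Literature.AlgebraicTopology.SingularHomology.RelativeCapProduct
import HarnessLib

/-!
# The cap product into `H₀`: `a ⌢ c = ⟨a, c⟩ · [pt]`; the degree-`0` end of Poincaré duality of the torus
# (Hatcher 2002, §3.3 p. 241, Thm. 3.30; Lange 2023, §2.5.3 Lemma 2.5.14)

Topic `Literature/AlgebraicTopology/SingularHomology`; lane `lit-hodgefound`, prover seat p20 gen 14 (rider to
row g14-#1, `TorusCapProductPontryaginMonomials.lean`). The duality map `a ↦ a ⌢ (λ_0 ⋆ ⋯ ⋆ λ_m)` of that file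
(`torusPoincareDualityMap`, bijective `Hᵖ(Tᵐ⁺¹; ℤ) → Hₗ₊₁(Tᵐ⁺¹; ℤ)` for `p + (l + 1) = m + 1`) stops at target
degree one; this file supplies the missing END `H^{m+1}(Tᵐ⁺¹; ℤ) → H₀(Tᵐ⁺¹; ℤ)`, by the general fact that a
cap product landing in `H₀` of a path-connected space is the Kronecker pairing times the point class.

Sources, VERBATIM. A. Hatcher, *Algebraic Topology* (CUP 2002), §3.3 p. 241: "for `ψ ∈ H⁰` the pairing
`ψ(α ⌢ φ) = (φ ⌣ ψ)(α)`" — with `ψ = 1` this reads `ε(α ⌢ φ) = φ(α)`, the tree's DEFINITION of the Kronecker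
pairing `⟨φ, α⟩ = ε(φ ⌢ α)` (`kroneckerPairing_apply`); Prop. 2.7 (p. 109): "If `X` is nonempty and
path-connected, then `H₀(X) ≈ ℤ` … the map `ε : C₀(X) → ℤ` sending `Σ nᵢσᵢ ↦ Σ nᵢ`"; Thm. 3.30 (p. 241):
"the map `D : Hᵏ(M; R) → H_{n−k}(M; R)` defined by `D(α) = [M] ⌢ α` is an isomorphism for all `k`".
H. Lange, *Abelian Varieties over the Complex Numbers* (Springer 2023), §2.5.3 Lemma 2.5.14 (p. 134): the
Poincaré duality isomorphism `P : H_p(X, ℤ) → H^{2g−p}(X, ℤ)` of a complex torus in ALL degrees `p`.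

## Contents (theorems only; no definition, no named fact)

* §1 `ε_pointClass`: `ε[r · x] = r`; `pointClass_mul`: `[(r s) · x] = r • [s · x]`; `pointClass_injective`;
  on a path-connected space `eq_pointClass_ε`: `c = [ε(c) · x₀]` for every `c ∈ H₀(X; R)`.
* §2 **`capProduct_eq_pointClass_kroneckerPairing`: `a ⌢ c = [⟨a, c⟩ · x₀]`** for `a ∈ Hⁿ(X; R)`,
  `c ∈ Hₙ(X; R)`, `X` path-connected (Hatcher p. 241 with `ψ = 1`, and Prop. 2.7: `ε` is injective on `H₀`).
* §3 the torus: **`capProduct_torusMonomial_topMonomial_top`: `ξ_σ ⌢ (λ_0 ⋆ ⋯ ⋆ λ_m) = [sign(σ) · pt]`**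
  for the top cup monomial `ξ_σ = ξ_{σ 0} ⌣ ⋯ ⌣ ξ_{σ m}` of a permutation `σ`;
  **`bijective_capProductWith_topMonomial_zero`: `a ↦ a ⌢ (λ_0 ⋆ ⋯ ⋆ λ_m) : H^{m+1}(Tᵐ⁺¹; ℤ) → H₀(Tᵐ⁺¹; ℤ)`
  is bijective** — the degree-`0` end of Hatcher's Thm. 3.30 / Lange's Lemma 2.5.14 for the torus.

## References

* A. Hatcher, *Algebraic Topology*, CUP 2002, §2.1 Prop. 2.7 (p. 109); §3.3 p. 241 and Thm. 3.30. [HatcherAT2002]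
* H. Lange, *Abelian Varieties over the Complex Numbers*, Springer 2023, §2.5.3 Lemma 2.5.14 (p. 134). [Lange2023AbelianVarietiesComplex]
-/

noncomputable section

open CategoryTheory Module

universe u v

namespace Literature.AlgebraicTopology.SingularHomology

open SingularSimplex singularChainComplex singularHomology

/-! ### §1. The augmentation on point classes -/

section PointClass

variable {R : Type v} [CommRing R] {X : Type u} [TopologicalSpace X]

/-- **`ε[r · x] = r`**: the augmentation of the class of the `0`-simplex at `x` with coefficient `r`.
[cite: HatcherAT2002, §2.1 Prop. 2.7 (p. 109)] -/
theorem ε_pointClass (r : R) (x : X) : singularHomology.ε R R X (pointClass R r x) = ULift.up r := by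
  have hz : (singularChainComplex R R X).d 0 0 (single (R := R) (ofPoint x) r) = 0 := by
    have h := d_zero_apply_eq_zero (R := R) (single (R := R) (ofPoint x) r)
    rwa [ChainComplex.next_nat_zero] at h
  rw [pointClass, homologyCls_eq_homologyπ_cyclesMk _ _ 0 ChainComplex.next_nat_zero hz,
    singularHomology.ε_homologyπ]
  have hi : iCycles R R X 0 ((singularChainComplex R R X).cyclesMk (single (R := R) (ofPoint x) r) 0
      ChainComplex.next_nat_zero hz) = single (R := R) (ofPoint x) r :=
    (singularChainComplex R R X).i_cyclesMk _ _ _ _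
  rw [hi, augment_single]

/-- `[(r s) · x] = r • [s · x]`. [cite: HatcherAT2002, §2.1 Prop. 2.7 (p. 109)] -/
theorem pointClass_mul (r s : R) (x : X) : pointClass R (r * s) x = r • pointClass R s x := by
  have h : single (R := R) (ofPoint x) (r * s) = r • single (R := R) (ofPoint x) s := by
    rw [← smul_eq_mul, single_smul]
  rw [pointClass, pointClass, ← homologyCls_smul r _ (d_zero_apply_eq_zero _) (d_zero_apply_eq_zero _)]
  exact homologyCls_congr h _ _

/-- `[r · x] = r • [1 · x]`. [cite: HatcherAT2002, §2.1 Prop. 2.7 (p. 109)] -/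
theorem pointClass_eq_smul_pointClass_one (r : R) (x : X) : pointClass R r x = r • pointClass R 1 x := by
  rw [← pointClass_mul, mul_one]

/-- `r ↦ [r · x]` is injective (`ε[r · x] = r`). [cite: HatcherAT2002, §2.1 Prop. 2.7 (p. 109)] -/
theorem pointClass_injective (x : X) : Function.Injective fun r : R ↦ pointClass R r x := by
  intro r s h
  have h1 := ε_pointClass r x
  rw [show pointClass R r x = pointClass R s x from h, ε_pointClass] at h1
  exact (congrArg ULift.down h1).symm

/-- `[1 · x] ≠ 0` in `H₀(X; R)` (for a nontrivial ring). [cite: HatcherAT2002, §2.1 Prop. 2.7 (p. 109)] -/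
theorem pointClass_one_ne_zero [Nontrivial R] (x : X) : pointClass R (1 : R) x ≠ 0 := by
  intro h
  have h1 := ε_pointClass (1 : R) x
  rw [h, map_zero] at h1
  exact one_ne_zero (congrArg ULift.down h1).symm

/-- Over `ℤ`: `[k · x] = k • [1 · x]` with the INTEGER scalar multiplication (`zsmul`) of the group `H₀(X; ℤ)`.
[cite: HatcherAT2002, §2.1 Prop. 2.7 (p. 109)] -/
theorem pointClass_int_eq_zsmul (k : ℤ) (x : X) : pointClass ℤ k x = k • pointClass ℤ (1 : ℤ) x := by
  rw [pointClass_eq_smul_pointClass_one]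
  exact int_smul_eq_zsmul _ _ _

/-- **`H₀` of a path-connected space: `c = [ε(c) · x₀]`** for every class `c` and every base point `x₀`
(`ε` is an isomorphism, Prop. 2.7). [cite: HatcherAT2002, §2.1 Prop. 2.7 (p. 109)] -/
theorem eq_pointClass_ε [PathConnectedSpace X] (x₀ : X) (c : singularHomology R R X 0) :
    c = pointClass R (singularHomology.ε R R X c).down x₀ := by
  haveI := singularHomology.isIso_ε_of_pathConnectedSpace R R (X := X)
  apply (asIso (singularHomology.ε R R X)).toLinearEquiv.injective
  rw [Iso.toLinearEquiv_apply, Iso.toLinearEquiv_apply, asIso_hom, ε_pointClass]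

/-! ### §2. `a ⌢ c = ⟨a, c⟩ · [pt]` -/

/-- **The cap product into `H₀` is the Kronecker pairing times the point class**: for `a ∈ Hⁿ(X; R)`,
`c ∈ Hₙ(X; R)` on a path-connected space, `a ⌢ c = [⟨a, c⟩ · x₀] ∈ H₀(X; R)` for any base point `x₀` —
Hatcher's "`ψ(α ⌢ φ) = (φ ⌣ ψ)(α)` for `ψ ∈ H⁰`" with `ψ = 1`, i.e. `ε(a ⌢ c) = ⟨a, c⟩`
(`kroneckerPairing_apply`), and `ε` is injective on `H₀` of a path-connected space (Prop. 2.7).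
[cite: HatcherAT2002, §3.3 p. 241; §2.1 Prop. 2.7 (p. 109)] -/
theorem capProduct_eq_pointClass_kroneckerPairing [PathConnectedSpace X] (x₀ : X) {n : ℕ} (h : n + 0 = n)
    (a : singularCohomology R R X n) (c : singularHomology R R X n) :
    capProduct h a c = pointClass R (kroneckerPairing R R X n a c) x₀ := by
  rw [eq_pointClass_ε x₀ (capProduct h a c), kroneckerPairing_apply]

/-- The same with the point class of `1`: `a ⌢ c = ⟨a, c⟩ • [1 · x₀]`. [cite: HatcherAT2002, §3.3 p. 241; §2.1 Prop. 2.7 (p. 109)] -/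
theorem capProduct_eq_kroneckerPairing_smul_pointClass [PathConnectedSpace X] (x₀ : X) {n : ℕ} (h : n + 0 = n)
    (a : singularCohomology R R X n) (c : singularHomology R R X n) :
    capProduct h a c = kroneckerPairing R R X n a c • pointClass R (1 : R) x₀ := by
  rw [capProduct_eq_pointClass_kroneckerPairing x₀ h, pointClass_eq_smul_pointClass_one]

end PointClass

/-! ### §3. The torus: `ξ_σ ⌢ (λ_0 ⋆ ⋯ ⋆ λ_m) = sign(σ) • [pt]`; `H^{m+1}(Tᵐ⁺¹; ℤ) ≅ H₀(Tᵐ⁺¹; ℤ)` -/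

section Torus

variable {m : ℕ}

/-- **`ξ_σ ⌢ (λ_0 ⋆ ⋯ ⋆ λ_m) = sign(σ) • [pt]`** in `H₀(Tᵐ⁺¹; ℤ)`: the top cup monomial
`ξ_σ = ξ_{σ 0} ⌣ ⋯ ⌣ ξ_{σ m}` of a permutation `σ` capped with the top Pontryagin monomial is the point class up
to the sign of `σ` (`⟨ξ_σ, λ_σ⟩ = 1`, `λ_0 ⋆ ⋯ ⋆ λ_m = sign(σ) • λ_σ`). The degree-`0` case left open by
`capProduct_torusMonomial_topMonomial`. [cite: HatcherAT2002, §3.3 Thm. 3.30 (p. 241), §3.2 Example 3.16] [cite: Lange2023AbelianVarietiesComplex, §2.5.3 Lemma 2.5.14 (p. 134)] -/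
theorem capProduct_torusMonomial_topMonomial_top (σ : Equiv.Perm (Fin (m + 1))) (h : (m + 1) + 0 = m + 1)
    (x₀ : Torus (m + 1)) :
    capProduct h (torusMonomial ℤ (m + 1) (m + 1) σ) (topMonomial m) =
      pointClass ℤ ((Equiv.Perm.sign σ : ℤˣ) : ℤ) x₀ := by
  rw [capProduct_eq_pointClass_kroneckerPairing x₀ h, topMonomial_eq_zsmul_pontryaginMonomial_perm σ,
    map_zsmul, kroneckerPairing_torusMonomial_pontryaginMonomial_self σ.injective, zsmul_eq_mul, mul_one,
    Int.cast_id]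

/-- `ξ_{id} ⌢ (λ_0 ⋆ ⋯ ⋆ λ_m) = [pt]`. [cite: HatcherAT2002, §3.3 Thm. 3.30 (p. 241)] [cite: Lange2023AbelianVarietiesComplex, §2.5.3 Lemma 2.5.14 (p. 134)] -/
theorem capProduct_torusMonomial_id_topMonomial (h : (m + 1) + 0 = m + 1) (x₀ : Torus (m + 1)) :
    capProduct h (torusMonomial ℤ (m + 1) (m + 1) (id : Fin (m + 1) → Fin (m + 1))) (topMonomial m) =
      pointClass ℤ (1 : ℤ) x₀ := by
  have key := capProduct_torusMonomial_topMonomial_top (Equiv.refl (Fin (m + 1))) h x₀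
  rwa [Equiv.Perm.sign_refl, Units.val_one] at key

/-- `H₀(Tᵐ⁺¹; ℤ)` is a finitely generated free `ℤ`-module of rank one (`ε : H₀ ≅ ℤ`, Prop. 2.7).
[cite: HatcherAT2002, §2.1 Prop. 2.7 (p. 109)] -/
theorem finrank_singularHomology_torus_zero : finrank ℤ (singularHomology ℤ ℤ (Torus (m + 1)) 0) = 1 := by
  haveI := singularHomology.isIso_ε_of_pathConnectedSpace ℤ ℤ (X := Torus (m + 1))
  rw [((asIso (singularHomology.ε ℤ ℤ (Torus (m + 1)))).toLinearEquiv.trans ULift.moduleEquiv).finrank_eq,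
    Module.finrank_self]

/-- **The degree-`0` end of Poincaré duality for the torus: `a ↦ a ⌢ (λ_0 ⋆ ⋯ ⋆ λ_m) : H^{m+1}(Tᵐ⁺¹; ℤ) →
H₀(Tᵐ⁺¹; ℤ)` is bijective** (`ξ_{id} ↦ [pt]`; both sides are free of rank one; Orzech's rank argument as in
`bijective_torusPoincareDualityMap`). [cite: HatcherAT2002, §3.3 Thm. 3.30 (p. 241)] [cite: Lange2023AbelianVarietiesComplex, §2.5.3 Lemma 2.5.14 (p. 134)] -/
theorem bijective_capProductWith_topMonomial_zero (h : (m + 1) + 0 = m + 1) :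
    Function.Bijective (capProductWith h (topMonomial m) :
      singularCohomology ℤ ℤ (Torus (m + 1)) (m + 1) →ₗ[ℤ] singularHomology ℤ ℤ (Torus (m + 1)) 0) := by
  haveI := singularHomology.isIso_ε_of_pathConnectedSpace ℤ ℤ (X := Torus (m + 1))
  let eε : singularHomology ℤ ℤ (Torus (m + 1)) 0 ≃ₗ[ℤ] ℤ :=
    (asIso (singularHomology.ε ℤ ℤ (Torus (m + 1)))).toLinearEquiv.trans ULift.moduleEquiv
  haveI : Module.Free ℤ (singularHomology ℤ ℤ (Torus (m + 1)) 0) := Module.Free.of_equiv eε.symm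
  haveI : Module.Finite ℤ (singularHomology ℤ ℤ (Torus (m + 1)) 0) := Module.Finite.equiv eε.symm
  have hsurj : Function.Surjective (capProductWith h (topMonomial m) :
      singularCohomology ℤ ℤ (Torus (m + 1)) (m + 1) →ₗ[ℤ] singularHomology ℤ ℤ (Torus (m + 1)) 0) := by
    intro c
    refine ⟨(singularHomology.ε ℤ ℤ (Torus (m + 1)) c).down •
      torusMonomial ℤ (m + 1) (m + 1) (id : Fin (m + 1) → Fin (m + 1)), ?_⟩
    rw [capProductWith_apply, capProduct_zsmul_left, capProduct_torusMonomial_id_topMonomial h (0 : Torus (m + 1)),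
      ← pointClass_int_eq_zsmul]
    exact (eq_pointClass_ε (0 : Torus (m + 1)) c).symm
  refine ⟨?_, hsurj⟩
  have hrank : finrank ℤ (singularCohomology ℤ ℤ (Torus (m + 1)) (m + 1)) =
      finrank ℤ (singularHomology ℤ ℤ (Torus (m + 1)) 0) := by
    rw [finrank_singularCohomology_torus_int', Nat.choose_self, finrank_singularHomology_torus_zero]
  let θ : singularHomology ℤ ℤ (Torus (m + 1)) 0 ≃ₗ[ℤ] singularCohomology ℤ ℤ (Torus (m + 1)) (m + 1) :=
    LinearEquiv.ofFinrankEq _ _ hrank.symm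
  have hF : Function.Injective (capProductWith h (topMonomial m) ∘ₗ θ.toLinearMap) :=
    OrzechProperty.injective_of_surjective_endomorphism _ (hsurj.comp θ.surjective)
  intro x y hxy
  have := @hF (θ.symm x) (θ.symm y) (by simpa using hxy)
  simpa using this

/-- Pointwise form: `a ⌢ (λ_0 ⋆ ⋯ ⋆ λ_m) = 0 ↔ a = 0` on `H^{m+1}(Tᵐ⁺¹; ℤ)`. [cite: HatcherAT2002, §3.3 Thm. 3.30 (p. 241)] -/
theorem capProduct_topMonomial_eq_zero_iff (h : (m + 1) + 0 = m + 1)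
    (a : singularCohomology ℤ ℤ (Torus (m + 1)) (m + 1)) :
    capProduct h a (topMonomial m) = 0 ↔ a = 0 := by
  refine ⟨fun ha ↦ (bijective_capProductWith_topMonomial_zero h).1 ?_,
    fun ha ↦ by rw [ha, map_zero, LinearMap.zero_apply]⟩
  rw [capProductWith_apply, capProductWith_apply, ha, map_zero, LinearMap.zero_apply]

end Torus

end Literature.AlgebraicTopology.SingularHomology
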